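import Summits.ValiantsHypothesis.ValiantsHypothesis.Theorems.LacunarySymmetroidMatrixDescartesCensusDoorA34FlagLaw

/-!
# `MatrixDescartes` census — DOOR A at `(3,4)`: the FLAG LAW on the SEMIDEFINITE CELL — no `(5, ≥ 1)` flag for the FULL middle window
# `a·adj G₀₀ + b·adj G₁₁` (`a, b ≥ 0`) past a middle-eigenvalue root

HONEST FRAMING.  Object-search cell `pub-symmetroid`, engine seat `val-sym-eng-2` (g3); helper row beside the registered strata line
`Cruxes/DoorA34/Lines/strata.lean` on stmt-ValiantsHypothesis-19980 (`DoorA34 = PosRootLawAt 3 4 18`: OPEN, typed, never asserted here), stub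
`stub_nullTopCeiling` OPEN on the generic sheet.  On the null-top stratum with a SEMIDEFINITE rank-two top letter `S₃ = diag(a, b, 0)` (`a, b ≥ 0`; every
`S₃ ⪰ 0` of rank two is congruent to one) the block identity `Census.det_pencil_nullTop_eq_blocks` reads
`det F = det G + X^N·(a·adj G₀₀ + b·adj G₁₁) + X^{2N}·ab·G₂₂`: the MIDDLE window is a non-negative combination of the two coordinate level-1 compressions
`e₀ᵀ adj G e₀`, `e₁ᵀ adj G e₁` and the TOP window vanishes exactly where `e₂` (the kernel of `S₃`) is isotropic for `G`.  The kernel FLAG LAW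
`Census.flagLaw_no_five_one` (…CensusDoorA34FlagLaw) forbids five roots of ONE coordinate compression between a type-`(−)` root `r` and an upper
junction `z`; this file extends it to the full semidefinite middle window, with no hierarchy `a ≫ b` assumed:

* `quadForm_adjugate_single_zero/one` — `e₀ᵀ adj A e₀ = A₁₁A₂₂ − A₁₂A₂₁`, `e₁ᵀ adj A e₁ = A₀₀A₂₂ − A₀₂A₂₀`;
* `adjugate_00_nonpos_of_corner`, `adjugate_11_nonpos_of_corner` — for symmetric `A` with `A₂₂ = 0` both are `≤ 0`;
* `signVariations_semidefWindow_le` — `C a·(e₀ᵀ adj F e₀) + C b·(e₁ᵀ adj F e₁)` lives on the six pair sums: at most `5` sign variations;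
* **`flagLaw_semidef_no_five_one`** — for a real symmetric three-letter `3 × 3` pencil, a det-root `r > 0` of type `(−)` (`tr adj F(r) < 0`), `a, b ≥ 0`,
  and `z > r` with `F(z)₂₂ = 0` (a root of the top window), the middle window `a·adj F₀₀ + b·adj F₁₁` does NOT have five distinct roots in `(r, z)`.
  So in the SEMIDEFINITE cell the `(5, 2)` anatomy `9 + 1 + 5 + 1 + 2` of a hierarchical null-top eighteen needs an ALL-`(+)` source whatever the
  ratio `a : b` (companions: …AllPlusSeven — located all-(+) capacity `7`; …SemidefSheet — the cell is hyperbolic in the unfolding parameter).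

Nothing here bounds `ζ_sym(3,4)`; the indefinite cell (`ab < 0`) is NOT covered (there the middle window is a DIFFERENCE and the sign argument at `r`
fails); nothing on `MatrixDescartes` (stmt-ValiantsHypothesis-18050) or `VP ≠ VNP` — VP≠VNP not moved.
[folklore] Descartes' rule with multiplicity + the rank-one adjugate at a simple root; bookkeeping over …CensusDoorA34FlagLaw.
-/

-- `Summit.ValiantsHypothesis.ValiantsHypothesis.…` repeats a component by the D-0017 layout
-- (single-conjunct summit), which the `dupNamespace` linter flags; the name is mandated.
set_option linter.dupNamespace false

namespace Summit.ValiantsHypothesis.ValiantsHypothesis.Theorems.LacunarySymmetroidMatrixDescartes.Census.SemidefFlag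

open Summit.ValiantsHypothesis.ValiantsHypothesis.Theorems.LacunarySymmetroidMatrixDescartes.Census
open scoped BigOperators Matrix
open Polynomial Finset

/-- `e₀ᵀ adj A e₀ = (adj A)₀₀ = A₁₁A₂₂ − A₁₂A₂₁`. [folklore] -/
theorem quadForm_adjugate_single_zero (A : Matrix (Fin 3) (Fin 3) ℝ) :
    (Pi.single (0 : Fin 3) (1 : ℝ)) ⬝ᵥ (A.adjugate *ᵥ Pi.single (0 : Fin 3) (1 : ℝ)) = A 1 1 * A 2 2 - A 1 2 * A 2 1 := by
  rw [Matrix.adjugate_fin_three]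
  simp [Matrix.mulVec, dotProduct, Fin.sum_univ_three]

/-- `e₁ᵀ adj A e₁ = (adj A)₁₁ = A₀₀A₂₂ − A₀₂A₂₀`. [folklore] -/
theorem quadForm_adjugate_single_one (A : Matrix (Fin 3) (Fin 3) ℝ) :
    (Pi.single (1 : Fin 3) (1 : ℝ)) ⬝ᵥ (A.adjugate *ᵥ Pi.single (1 : Fin 3) (1 : ℝ)) = A 0 0 * A 2 2 - A 0 2 * A 2 0 := by
  rw [Matrix.adjugate_fin_three]
  simp [Matrix.mulVec, dotProduct, Fin.sum_univ_three]

/-- At a root of the top window (`A₂₂ = 0`, `e₂` isotropic) the compression to `e₀^⊥` is non-definite: `A₁₁A₂₂ − A₁₂A₂₁ ≤ 0` for symmetric `A`. [folklore] -/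
theorem adjugate_00_nonpos_of_corner {A : Matrix (Fin 3) (Fin 3) ℝ} (hA : A.IsSymm) (h22 : A 2 2 = 0) :
    A 1 1 * A 2 2 - A 1 2 * A 2 1 ≤ 0 := by
  have h21 : A 2 1 = A 1 2 := by
    have h := congrFun (congrFun hA 2) 1
    simp [Matrix.transpose_apply] at h
    exact h.symm
  rw [h22, h21]
  nlinarith [sq_nonneg (A 1 2)]

/-- Likewise `A₀₀A₂₂ − A₀₂A₂₀ ≤ 0` at `A₂₂ = 0`. [folklore] -/
theorem adjugate_11_nonpos_of_corner {A : Matrix (Fin 3) (Fin 3) ℝ} (hA : A.IsSymm) (h22 : A 2 2 = 0) :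
    A 0 0 * A 2 2 - A 0 2 * A 2 0 ≤ 0 := by
  have h20 : A 2 0 = A 0 2 := by
    have h := congrFun (congrFun hA 2) 0
    simp [Matrix.transpose_apply] at h
    exact h.symm
  rw [h22, h20]
  nlinarith [sq_nonneg (A 0 2)]

/-- **The semidefinite middle window has at most `5` sign variations** (it lives on the six pair sums). [folklore] -/
theorem signVariations_semidefWindow_le (d : Fin 3 → ℕ) (S : Fin 3 → Matrix (Fin 3) (Fin 3) ℝ) (a b : ℝ) :
    (C a * (∑ i, ∑ j, C ((Pi.single (0 : Fin 3) (1 : ℝ) : Fin 3 → ℝ) i * (Pi.single (0 : Fin 3) (1 : ℝ) : Fin 3 → ℝ) j) *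
          (∑ l, ((X : ℝ[X]) ^ d l) • (S l).map C).adjugate i j)
      + C b * (∑ i, ∑ j, C ((Pi.single (1 : Fin 3) (1 : ℝ) : Fin 3 → ℝ) i * (Pi.single (1 : Fin 3) (1 : ℝ) : Fin 3 → ℝ) j) *
          (∑ l, ((X : ℝ[X]) ^ d l) • (S l).map C).adjugate i j)).signVariations ≤ 5 := by
  set g := C a * (∑ i, ∑ j, C ((Pi.single (0 : Fin 3) (1 : ℝ) : Fin 3 → ℝ) i * (Pi.single (0 : Fin 3) (1 : ℝ) : Fin 3 → ℝ) j) *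
          (∑ l, ((X : ℝ[X]) ^ d l) • (S l).map C).adjugate i j)
      + C b * (∑ i, ∑ j, C ((Pi.single (1 : Fin 3) (1 : ℝ) : Fin 3 → ℝ) i * (Pi.single (1 : Fin 3) (1 : ℝ) : Fin 3 → ℝ) j) *
          (∑ l, ((X : ℝ[X]) ^ d l) • (S l).map C).adjugate i j) with hg
  by_cases h0 : g = 0
  · rw [h0]; simp
  · have h1 := Literature.Computability.AlgebraicComplexity.signVariations_lt_card_support h0
    have hsub : g.support ⊆ (Finset.univ : Finset (Fin 2 → Fin 3)).image (fun f => ∑ i, d (f i)) := by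
      rw [hg, Polynomial.C_mul', Polynomial.C_mul']
      refine (Polynomial.support_add).trans (Finset.union_subset ?_ ?_)
      · exact (Polynomial.support_smul _ _).trans (support_quadForm_adjugate_pencil_subset' d S _)
      · exact (Polynomial.support_smul _ _).trans (support_quadForm_adjugate_pencil_subset' d S _)
    have h2 : g.support.card ≤ 6 := (Finset.card_le_card hsub).trans (card_pairSums_three_le d)
    omega

/-- **FLAG LAW ON THE SEMIDEFINITE CELL — no `(5, ≥ 1)` flag for the full middle window past a middle-eigenvalue root.**  Let
`F(x) = Σ_l x^{d l} S_l` be a real symmetric `3 × 3` pencil with three letters, `r > 0` a det-root of type `(−)` (`tr adj F(r) < 0`), `a, b ≥ 0`, and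
`z > r` a point where `e₂` is isotropic (`F(z)₂₂ = 0`: a root of the top window `ab·F₂₂` of the null-top pencil `F + X^N·diag(a,b,0)`).  Then the
middle window `a·adj F₀₀ + b·adj F₁₁` does not have five distinct roots in `(r, z)`. [folklore] -/
theorem flagLaw_semidef_no_five_one (d : Fin 3 → ℕ) (S : Fin 3 → Matrix (Fin 3) (Fin 3) ℝ) (hS : ∀ l, (S l).IsSymm)
    {r z : ℝ} (hr : 0 < r) (hrz : r < z)
    (hroot : (∑ l, r ^ d l • S l).det = 0) (htype : (∑ l, r ^ d l • S l).adjugate.trace < 0)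
    {a b : ℝ} (ha : 0 ≤ a) (hb : 0 ≤ b)
    (Y : Finset ℝ) (hYcard : Y.card = 5)
    (hY : ∀ y ∈ Y, r < y ∧ y < z ∧
      y ∈ (C a * (∑ i, ∑ j, C ((Pi.single (0 : Fin 3) (1 : ℝ) : Fin 3 → ℝ) i * (Pi.single (0 : Fin 3) (1 : ℝ) : Fin 3 → ℝ) j) *
              (∑ l, ((X : ℝ[X]) ^ d l) • (S l).map C).adjugate i j)
          + C b * (∑ i, ∑ j, C ((Pi.single (1 : Fin 3) (1 : ℝ) : Fin 3 → ℝ) i * (Pi.single (1 : Fin 3) (1 : ℝ) : Fin 3 → ℝ) j) *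
              (∑ l, ((X : ℝ[X]) ^ d l) • (S l).map C).adjugate i j)).roots)
    (hz : (∑ l, z ^ d l • S l) 2 2 = 0) : False := by
  classical
  set c0 : Fin 3 → ℝ := Pi.single (0 : Fin 3) (1 : ℝ) with hc0
  set c1 : Fin 3 → ℝ := Pi.single (1 : Fin 3) (1 : ℝ) with hc1
  set q0 := ∑ i, ∑ j, C (c0 i * c0 j) * (∑ l, ((X : ℝ[X]) ^ d l) • (S l).map C).adjugate i j with hq0
  set q1 := ∑ i, ∑ j, C (c1 i * c1 j) * (∑ l, ((X : ℝ[X]) ^ d l) • (S l).map C).adjugate i j with hq1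
  set g := C a * q0 + C b * q1 with hgdef
  have hne : Y.Nonempty := by rw [← Finset.card_pos, hYcard]; norm_num
  obtain ⟨y₀, hy₀⟩ := hne
  have hg0 : g ≠ 0 := (Polynomial.mem_roots'.mp (hY y₀ hy₀).2.2).1
  have hY' : ∀ y ∈ Y, r < y ∧ y < z ∧ g.IsRoot y := fun y hy =>
    ⟨(hY y hy).1, (hY y hy).2.1, (Polynomial.mem_roots'.mp (hY y hy).2.2).2⟩
  have hcount : g.roots.countP (fun x => 0 < x) ≤ Y.card := by
    rw [hYcard]
    exact (Polynomial.roots_countP_pos_le_signVariations g).trans (signVariations_semidefWindow_le d S a b)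
  have hsign := eval_mul_eval_sign_of_roots_between g hg0 hr hrz Y hY' hcount
  rw [hYcard] at hsign
  have hprod : g.eval r * g.eval z < 0 := by
    have h5 : (-1 : ℝ) ^ 5 = -1 := by norm_num
    rw [h5] at hsign; linarith
  -- `g(r) ≤ 0`: both coordinate compressions are `≤ 0` at the type-(−) root and `a, b ≥ 0`
  have hgr : g.eval r ≤ 0 := by
    have e0 : q0.eval r ≤ 0 := by
      rw [hq0, eval_quadForm_adjugate_pencil']
      exact quadForm_adjugate_nonpos_of_type_neg (isSymm_pencil_eval d hS r) hroot htype c0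
    have e1 : q1.eval r ≤ 0 := by
      rw [hq1, eval_quadForm_adjugate_pencil']
      exact quadForm_adjugate_nonpos_of_type_neg (isSymm_pencil_eval d hS r) hroot htype c1
    rw [hgdef, eval_add, eval_mul, eval_mul, eval_C, eval_C]
    nlinarith
  -- `g(z) ≤ 0`: at a root of the top window both compressions are `≤ 0`
  have hgz : g.eval z ≤ 0 := by
    have e0 : q0.eval z ≤ 0 := by
      rw [hq0, eval_quadForm_adjugate_pencil', hc0, quadForm_adjugate_single_zero]
      exact adjugate_00_nonpos_of_corner (isSymm_pencil_eval d hS z) hz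
    have e1 : q1.eval z ≤ 0 := by
      rw [hq1, eval_quadForm_adjugate_pencil', hc1, quadForm_adjugate_single_one]
      exact adjugate_11_nonpos_of_corner (isSymm_pencil_eval d hS z) hz
    rw [hgdef, eval_add, eval_mul, eval_mul, eval_C, eval_C]
    nlinarith
  have : 0 ≤ g.eval r * g.eval z := mul_nonneg_of_nonpos_of_nonpos hgr hgz
  linarith

end Summit.ValiantsHypothesis.ValiantsHypothesis.Theorems.LacunarySymmetroidMatrixDescartes.Census.SemidefFlag
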